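import Summits.Ventures.HodgeRepro2.T6B1Hyp
import Summits.Ventures.HodgeRepro2.T6B1Local

/-!
# T6B1Construct — the global hermitian space `V(τ) = (E³, diag(1, 1, α))` (Tier-6 sub-goal B1, proof lane)

Steps 1–3 of route/T6-B1-t6-p4.md §3 (= TIER4 B1, Lemmas B1.2.1, B1.4.1 / B1.4.2 in the kernel's order):

1. `exists_fin_not_isSquare`: θ a non-square in `K` ⟹ some DISCRETE spot `v₀` has θ a non-square in `K_{v₀}`
   (from the displayed Global Square Theorem `Hyp.OMeara1963_65_15`);
2. `exists_alpha`: for a real place `τ` with `θ < 0` at `τ`, an `α ∈ K^×` with `(α, θ)_𝔭 = −1` exactly at `𝔭 ∈ {v₀, τ}`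
   (from the displayed `Hyp.OMeara1963_71_19` with `T = {v₀, τ}`, `β = θ`);
3. the global space `W α := (E³, diag(1, 1, α))` and its real-place invariants: `diag(1, 1, α_w)` over `ℂ`,
   signature `(2, 1)` at `τ` (α_τ < 0), positive definite at every real `w ≠ τ` (α_w > 0).
-/

namespace Summit.Ventures.HodgeRepro2.T6
namespace B1Construct

open NumberField IsDedekindDomain Matrix B1Carriers B1Local
open scoped ComplexOrder

noncomputable section

variable (K : Type*) [Field K]

/-- `realExtToComplex` unfolded. -/
@[simp] theorem realExtToComplex_apply (t : ℝ) (z : Ext ℝ t) :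
    realExtToComplex t z = (z.re : ℂ) + (z.im : ℂ) * csqrt t := rfl

/-- `extMap` unfolded. -/
theorem extMap_apply {R S : Type*} [CommRing R] [CommRing S] (f : R →+* S) {θ : R} {θ' : S} (h : f θ = θ')
    (z : Ext R θ) : extMap f h z = ⟨f z.re, f z.im⟩ := rfl

/-! ## Real places: reading the symbol and squares in `ℝ` -/

/-- The symbol at a real place, read in `ℝ` through `K_w ≃ ℝ`. -/
theorem hilbertInf_eq_real {w : InfinitePlace K} (hw : w.IsReal) (α β : K) :
    hilbertInf K w α β = hilbertSymbol ℝ (realOf K hw α) (realOf K hw β) := by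
  unfold hilbertInf realOf
  rw [hilbertSymbol_map]

/-- Squares at a real place, read in `ℝ`. -/
theorem isSquareAtInf_iff_real {w : InfinitePlace K} (hw : w.IsReal) (θ : K) :
    IsSquareAtInf K w θ ↔ IsSquare (realOf K hw θ) := by
  unfold IsSquareAtInf realOf
  rw [isSquare_map_iff]

/-- `realOf` is a ring homomorphism `K → ℝ` (the real embedding at `w`). -/
def realOfHom {w : InfinitePlace K} (hw : w.IsReal) : K →+* ℝ :=
  (InfinitePlace.Completion.ringEquivRealOfIsReal hw).toRingHom.comp (algebraMap K w.Completion)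

/-- `realOfHom` agrees with `realOf`. -/
theorem realOfHom_apply {w : InfinitePlace K} (hw : w.IsReal) (x : K) : realOfHom K hw x = realOf K hw x := rfl

/-- `realOf` is injective. -/
theorem realOf_injective {w : InfinitePlace K} (hw : w.IsReal) : Function.Injective (realOf K hw) :=
  (realOfHom K hw).injective

/-- `realOf` of a non-zero element is non-zero. -/
theorem realOf_ne_zero {w : InfinitePlace K} (hw : w.IsReal) {x : K} (hx : x ≠ 0) : realOf K hw x ≠ 0 := by
  intro h
  apply hx
  apply realOf_injective K hw
  rw [h, ← realOfHom_apply, map_zero]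

/-- `2 ≠ 0` in any `K`-algebra that is a field, `K` of characteristic zero. -/
theorem two_ne_zero_of_algebra [CharZero K] (L : Type*) [Field L] [Algebra K L] : (2 : L) ≠ 0 := by
  rw [← map_ofNat (algebraMap K L) 2]
  exact (map_ne_zero (algebraMap K L)).2 two_ne_zero

/-- A non-square is non-zero. -/
theorem ne_zero_of_not_isSquare {θ : K} (hθ : ¬ IsSquare θ) : θ ≠ 0 := by
  rintro rfl; exact hθ ⟨0, by simp⟩

/-- The image of an element of `K` in `E = K(√θ)` is self-adjoint. -/
theorem isSelfAdjoint_algebraMap (θ : K) (a : K) : IsSelfAdjoint (algebraMap K (Ext K θ) a) := by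
  rw [isSelfAdjoint_iff]
  ext <;> simp [QuadraticAlgebra.algebraMap_eq]

variable [NumberField K]

/-! ## Step 1: a discrete spot where θ is a non-square -/

/-- From the Global Square Theorem: a non-square of `K` is a non-square at some discrete spot. -/
theorem exists_fin_not_isSquare (h : Hyp.OMeara1963_65_15 K) {θ : K} (hθ : ¬ IsSquare θ) :
    ∃ v : HeightOneSpectrum (𝓞 K), ¬ IsSquareAtFin K v θ := by
  by_contra hcon
  have hall : ∀ v : HeightOneSpectrum (𝓞 K), IsSquareAtFin K v θ := fun v =>
    by_contra fun hv => hcon ⟨v, hv⟩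
  apply hθ
  apply h θ
  · have : {v : HeightOneSpectrum (𝓞 K) | ¬ IsSquareAtFin K v θ} = ∅ := by
      ext v; simp [hall v]
    rw [this]; exact Set.finite_empty
  · exact Set.toFinite _

/-! ## Step 2: the element α with prescribed symbols -/

open Classical in
/-- From 71:19 / 71:19a with `T = {v₀, τ}` and `β = θ`: an `α ≠ 0` whose symbol with θ is `−1` at `v₀` and at `τ`, and
`1` at every other spot. -/
theorem exists_alpha (h : Hyp.OMeara1963_71_19 K) {θ : K} (v₀ : HeightOneSpectrum (𝓞 K))
    (hv₀ : ¬ IsSquareAtFin K v₀ θ) {τ : InfinitePlace K} (hτ : τ.IsReal) (hθτ : realOf K hτ θ < 0) :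
    ∃ α : K, α ≠ 0 ∧ (∀ v, hilbertFin K v α θ = if v = v₀ then -1 else 1) ∧
      (∀ w, hilbertInf K w α θ = if w = τ then -1 else 1) := by
  classical
  have hθ0 : θ ≠ 0 := by
    rintro rfl
    exact hv₀ ⟨0, by simp⟩
  have hτsq : ¬ IsSquareAtInf K τ θ := by
    rw [isSquareAtInf_iff_real K hτ]
    exact B1Local.not_isSquare_of_neg hθτ
  obtain ⟨α, hα0, hfin, hinf⟩ := h {v₀} {τ} (by simpa using hτ) (by simp) θ hθ0
    (by simpa using hv₀) (by simpa using hτsq)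
  refine ⟨α, hα0, fun v => ?_, fun w => ?_⟩
  · rw [hfin v]; simp
  · rw [hinf w]; simp

/-! ## Step 3: the global space `W α = (E³, diag(1, 1, α))` -/

/-- The diagonal entries `(1, 1, α)` of `W α`, in `E`. -/
def wDiag (θ : K) (α : K) : Fin 3 → Ext K θ :=
  ![1, 1, algebraMap K (Ext K θ) α]

/-- The global hermitian space `W α = (E³, diag(1, 1, α))` for `α ≠ 0`. -/
def W (θ : K) {α : K} (hα : α ≠ 0) : GlobalHermitianSpace K θ 3 where
  gram := Matrix.diagonal (wDiag K θ α)
  isHermitian := by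
    rw [Matrix.isHermitian_diagonal_iff]
    intro i
    fin_cases i
    · rw [isSelfAdjoint_iff]; exact star_one _
    · rw [isSelfAdjoint_iff]; exact star_one _
    · exact isSelfAdjoint_algebraMap K θ α
  isUnit_det := by
    rw [Matrix.det_diagonal, Fin.prod_univ_three]
    simp only [wDiag, Matrix.cons_val_zero, Matrix.cons_val_one, Matrix.cons_val_two, Matrix.head_cons,
      Matrix.tail_cons, one_mul]
    exact (isUnit_iff_ne_zero.2 hα).map (algebraMap K (Ext K θ))

omit [NumberField K] in
/-- The Gram matrix of `W α`. -/
theorem W_gram (θ : K) {α : K} (hα : α ≠ 0) : (W K θ hα).gram = Matrix.diagonal (wDiag K θ α) := rfl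

omit [NumberField K] in
/-- `globalToComplex` on the image of `a ∈ K` is the real number `a_w`. -/
theorem globalToComplex_algebraMap (θ : K) {w : InfinitePlace K} (hw : w.IsReal) (a : K) :
    globalToComplex K θ hw (algebraMap K (Ext K θ) a) = (realOf K hw a : ℂ) := by
  simp only [globalToComplex, RingHom.comp_apply, extMap_apply, QuadraticAlgebra.algebraMap_eq,
    realExtToComplex_apply, map_zero, Complex.ofReal_zero, zero_mul, add_zero]
  rfl

omit [NumberField K] in
/-- `W α ⊗_{K,w} ℝ` is `diag(1, 1, α_w)` over `ℂ`. -/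
theorem globalGramAt_W (θ : K) {α : K} (hα : α ≠ 0) {w : InfinitePlace K} (hw : w.IsReal) :
    globalGramAt K (W K θ hα) hw = Matrix.diagonal ![1, 1, (realOf K hw α : ℂ)] := by
  unfold globalGramAt
  rw [W_gram, Matrix.diagonal_map (map_zero _)]
  congr 1
  ext i
  fin_cases i
  · simp [wDiag]
  · simp [wDiag]
  · simp [wDiag, globalToComplex_algebraMap]

/-- `diag(1, 1, c)` with `c < 0` has signature `(2, 1)`: `P = diag(1, 1, 1/√(−c))`. -/
theorem hasSig_diag_neg {c : ℝ} (hc : c < 0) : HasSig (Matrix.diagonal ![1, 1, (c : ℂ)]) 2 1 := by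
  have hs0 : Real.sqrt (-c) ≠ 0 := (Real.sqrt_pos.2 (by linarith)).ne'
  have hs : Real.sqrt (-c) * Real.sqrt (-c) = -c := Real.mul_self_sqrt (by linarith)
  refine ⟨rfl, Matrix.diagonal ![1, 1, ((1 / Real.sqrt (-c) : ℝ) : ℂ)], ?_, ?_⟩
  · rw [Matrix.det_diagonal, Fin.prod_univ_three]
    simp only [Matrix.cons_val_zero, Matrix.cons_val_one, Matrix.cons_val_two, Matrix.head_cons,
      Matrix.tail_cons, one_mul]
    rw [isUnit_iff_ne_zero]
    exact_mod_cast one_div_ne_zero hs0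
  · rw [Matrix.diagonal_conjTranspose, Matrix.diagonal_mul_diagonal, Matrix.diagonal_mul_diagonal]
    congr 1
    ext i
    fin_cases i
    · simp
    · simp
    · simp only [Fin.reduceFinMk, Matrix.cons_val_two, Matrix.tail_cons, Matrix.head_cons, Pi.star_apply,
        Complex.star_def, Complex.conj_ofReal, Nat.lt_irrefl, ↓reduceIte, Fin.isValue]
      rw [← Complex.ofReal_mul, ← Complex.ofReal_mul]
      have : 1 / Real.sqrt (-c) * c * (1 / Real.sqrt (-c)) = -1 := by
        field_simp
        linear_combination hs
      rw [this]; push_cast; rfl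

/-- `diag(1, 1, c)` with `c > 0` is positive definite. -/
theorem posDef_diag_pos {c : ℝ} (hc : 0 < c) : (Matrix.diagonal ![1, 1, (c : ℂ)]).PosDef := by
  rw [Matrix.posDef_diagonal_iff]
  intro i
  fin_cases i
  · simp
  · simp
  · simpa using hc

omit [NumberField K] in
/-- At a real place where the symbol `(α, θ)_w = 1` and `θ_w < 0`, the global space `W α` is positive definite. -/
theorem posDef_W_of_symbol_one (θ : K) {α : K} (hα : α ≠ 0) {w : InfinitePlace K} (hw : w.IsReal)
    (hθw : realOf K hw θ < 0) (hsym : hilbertInf K w α θ = 1) :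
    (globalGramAt K (W K θ hα) hw).PosDef := by
  rw [globalGramAt_W]
  apply posDef_diag_pos
  rw [hilbertInf_eq_real K hw, hilbertSymbol_real_eq_one_iff hθw] at hsym
  exact hsym

omit [NumberField K] in
/-- At a real place where the symbol `(α, θ)_w = −1` and `θ_w < 0`, the global space `W α` has signature `(2, 1)`. -/
theorem hasSig_W_of_symbol_neg_one (θ : K) {α : K} (hα : α ≠ 0) {w : InfinitePlace K} (hw : w.IsReal)
    (hθw : realOf K hw θ < 0) (hsym : hilbertInf K w α θ = -1) :
    HasSig (globalGramAt K (W K θ hα) hw) 2 1 := by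
  rw [globalGramAt_W]
  apply hasSig_diag_neg
  rw [hilbertInf_eq_real K hw, hilbertSymbol_real_eq_neg_one_iff hθw (realOf_ne_zero K hw hα)] at hsym
  exact hsym

end

end B1Construct
end Summit.Ventures.HodgeRepro2.T6
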